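import Literature.Probability.HeavyTails.FrechetLaw
import HarnessLib

/-!
# The extreme value distributions `G_γ` as probability MEASURES (de Haan–Ferreira Thm 1.1.3)

Topic `Probability/HeavyTails`, companion of `FrechetLaw.lean`, which DEFINES the distribution functions
`gevCDF γ` (`G_γ(x) = exp(−(1 + γx)^{−1/γ})` on `1 + γx > 0`, de Haan–Ferreira (1.1.9); `γ = 0` read as
the Gumbel `G_0`), proves the class identities (a)/(b)/(c), max-stability and the `γ → 0` limit, and builds
the MEASURES only for `γ = 0` (`gumbelMeasure`) and, in Fréchet coordinates, `γ > 0` (`frechetMeasure`).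
This file supplies `G_γ` ITSELF as a probability measure on `ℝ` for EVERY `γ` (v43 (R11)(iii) of the
pub-qed literature seat: "G_γ / Ψ_α as MEASURES"), VALUE-FREE.

DEFINITION (no Stieltjes casework): inside its support `G_γ` is the Gumbel law in the coordinate
`log(1 + γx)/γ` (`FrechetLaw.gevCDF_eq_gumbelCDF_log_div`), i.e. `G_γ` is the law of
`(e^{γY} − 1)/γ` for `Y ∼ G_0`; so

  `gevMeasure γ := gumbelMeasure.map (fun y => (exp (γy) − 1)/γ)`  (`γ ≠ 0`),  `gevMeasure 0 := gumbelMeasure`.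

PROVED: `isProbabilityMeasure_gevMeasure`; **`gevMeasure_real_Iic`** — `(gevMeasure γ)(−∞, x] = G_γ(x)` for
ALL `γ, x` (the three printed cases: inside the support, left of the left endpoint `−1/γ` when `γ > 0`
(mass `0`), right of the right endpoint `−1/γ` when `γ < 0` (mass `1`)); **`cdf_gevMeasure`** (the
distribution function of `gevMeasure γ` IS `gevCDF γ`, hence `gevMeasure γ` is THE law with distribution
function (1.1.9) — `Measure.eq_of_cdf`); `gevMeasure_zero`; `gevMeasure_eq_of_cdf_eq` (any probability
measure with distribution function `G_γ` is `gevMeasure γ`); the preimage computations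
`preimage_expTransform_Iic_of_pos` / `_of_nonpos_of_pos` / `_of_nonpos_of_neg`.
(v2) § `GEVSupport` — `gevMeasure_real_Iic_eq_zero_of_pos` / `gevMeasure_real_Iic_leftEndpoint` (γ > 0:
no mass at or below `−1/γ`), `gevMeasure_real_Ioi_eq_zero_of_neg` / `gevMeasure_real_Iic_rightEndpoint`
(γ < 0: no mass beyond `−1/γ`); § `FrechetClass` — **`gevMeasure_eq_map_frechetMeasure`**: for `γ > 0`,
`gevMeasure γ = (frechetMeasure (1/γ)).map (x ↦ (x − 1)/γ)` (§1.1.3 (a) at the level of measures).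
(v3) § `ReverseWeibull` — **`reverseWeibullMeasure α`** (the law `Ψ_α` as a measure: pushforward of `G_0` under
`y ↦ −e^{−y/α}`), `reverseWeibullMeasure_real_Iic` / `cdf_reverseWeibullMeasure` (`= FrechetLaw.reverseWeibullCDF α`,
`α > 0`), `reverseWeibullMeasure_real_Ioi_zero` (right endpoint `0`), and **`gevMeasure_eq_map_reverseWeibullMeasure`**:
for `γ < 0`, `gevMeasure γ = (reverseWeibullMeasure (−1/γ)).map (x ↦ −(1 + x)/γ)` (§1.1.3 (c) at the level of
measures) — so all three classes (a)/(b)/(c) of Thm 1.1.3 are identified as MEASURES.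

SOURCE: L. de Haan, A. Ferreira, *Extreme Value Theory* (Springer 2006) [deHaanFerreira2006], Theorem 1.1.3
with (1.1.9) "`G_γ(x) = exp(−(1 + γx)^{−1/γ})`, `1 + γx > 0`" and §1.1.3 (a) "For `γ > 0` … the right
endpoint of the distribution is infinity", (b) "`γ = 0` … `G_0(x) = exp(−e^{−x})`", (c) "For `γ < 0` the
right endpoint of the distribution is `−1/γ`" — as already cited verbatim in `FrechetLaw.lean` § GEV.
NOT typed: the converse half of Thm 1.1.3 (only these limits occur), densities / moments of `G_γ` and `Ψ_α`.
-/

noncomputable section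

namespace Literature.Probability.HeavyTails

open MeasureTheory ProbabilityTheory Set Real Filter
open scoped Topology

section GEVMeasure

variable {γ : ℝ}

/-- **The extreme value distribution `G_γ` as a measure on `ℝ`**: the law of `(e^{γY} − 1)/γ` for
`Y ∼ G_0` (Gumbel) when `γ ≠ 0`, and `G_0` itself when `γ = 0` (de Haan–Ferreira Thm 1.1.3, (1.1.9):
inside its support `G_γ(x) = G_0(log(1 + γx)/γ)`). [cite: deHaanFerreira2006, Theorem 1.1.3 (1.1.9)] -/
def gevMeasure (γ : ℝ) : Measure ℝ :=
  if γ = 0 then gumbelMeasure else gumbelMeasure.map fun y => (Real.exp (γ * y) - 1) / γ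

/-- `G_0` is the Gumbel law (definitional). [cite: deHaanFerreira2006, Theorem 1.1.3 (1.1.9), §1.1.3 (b)] -/
@[simp] theorem gevMeasure_zero : gevMeasure 0 = gumbelMeasure := by
  simp [gevMeasure]

/-- Unfolding for `γ ≠ 0`. [cite: deHaanFerreira2006, Theorem 1.1.3 (1.1.9)] -/
theorem gevMeasure_of_ne_zero (hγ : γ ≠ 0) :
    gevMeasure γ = gumbelMeasure.map fun y => (Real.exp (γ * y) - 1) / γ := by
  simp [gevMeasure, hγ]

/-- The coordinate change `y ↦ (e^{γy} − 1)/γ` is measurable. [folklore] -/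
private theorem measurable_expTransform (γ : ℝ) :
    Measurable fun y : ℝ => (Real.exp (γ * y) - 1) / γ :=
  ((Real.measurable_exp.comp (measurable_const.mul measurable_id)).sub measurable_const).div_const γ

/-- `G_γ` is a probability measure. [cite: deHaanFerreira2006, Theorem 1.1.3 (G_γ is a distribution function)] -/
instance isProbabilityMeasure_gevMeasure (γ : ℝ) : IsProbabilityMeasure (gevMeasure γ) := by
  by_cases hγ : γ = 0
  · rw [hγ, gevMeasure_zero]; infer_instance
  · rw [gevMeasure_of_ne_zero hγ]
    exact Measure.isProbabilityMeasure_map (measurable_expTransform γ).aemeasurable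

/-- Inside the support (`1 + γx > 0`, `γ ≠ 0`) the event `(e^{γY} − 1)/γ ≤ x` is `Y ≤ log(1 + γx)/γ`
(for either sign of `γ`: `exp` and `log` are increasing, and dividing by `γ` twice restores the
direction). [cite: deHaanFerreira2006, Theorem 1.1.3 (1.1.9)] -/
theorem preimage_expTransform_Iic_of_pos (hγ : γ ≠ 0) {x : ℝ} (h : 0 < 1 + γ * x) :
    (fun y : ℝ => (Real.exp (γ * y) - 1) / γ) ⁻¹' Iic x = Iic (Real.log (1 + γ * x) / γ) := by
  ext y
  simp only [mem_preimage, mem_Iic]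
  rcases lt_or_gt_of_ne hγ with hneg | hpos
  · rw [div_le_iff_of_neg hneg, le_div_iff_of_neg hneg]
    constructor
    · intro hy
      -- `x γ ≤ e^{γy} − 1`, i.e. `1 + γx ≤ e^{γy}`; take logs
      have h1 : 1 + γ * x ≤ Real.exp (γ * y) := by linarith
      have := Real.log_le_log h h1
      rw [Real.log_exp] at this
      linarith
    · intro hy
      have h1 : Real.log (1 + γ * x) ≤ γ * y := by linarith
      have := Real.exp_le_exp.2 h1
      rw [Real.exp_log h] at this
      linarith
  · rw [div_le_iff₀ hpos, le_div_iff₀ hpos]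
    constructor
    · intro hy
      have h1 : Real.exp (γ * y) ≤ 1 + γ * x := by linarith
      have := Real.log_le_log (Real.exp_pos _) h1
      rw [Real.log_exp] at this
      linarith
    · intro hy
      have h1 : γ * y ≤ Real.log (1 + γ * x) := by linarith
      have := Real.exp_le_exp.2 h1
      rw [Real.exp_log h] at this
      linarith

/-- Left of the left endpoint (`γ > 0`, `1 + γx ≤ 0`): the event is empty (`(e^{γY} − 1)/γ > −1/γ ≥ x`).
[cite: deHaanFerreira2006, §1.1.3 (a)] -/
theorem preimage_expTransform_Iic_of_nonpos_of_pos (hγ : 0 < γ) {x : ℝ} (h : 1 + γ * x ≤ 0) :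
    (fun y : ℝ => (Real.exp (γ * y) - 1) / γ) ⁻¹' Iic x = ∅ := by
  ext y
  simp only [mem_preimage, mem_Iic, mem_empty_iff_false, iff_false, not_le, lt_div_iff₀ hγ]
  have := Real.exp_pos (γ * y)
  linarith

/-- Right of the right endpoint (`γ < 0`, `1 + γx ≤ 0`): the event is sure (`(e^{γY} − 1)/γ < −1/γ ≤ x`).
[cite: deHaanFerreira2006, §1.1.3 (c)] -/
theorem preimage_expTransform_Iic_of_nonpos_of_neg (hγ : γ < 0) {x : ℝ} (h : 1 + γ * x ≤ 0) :
    (fun y : ℝ => (Real.exp (γ * y) - 1) / γ) ⁻¹' Iic x = univ := by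
  ext y
  simp only [mem_preimage, mem_Iic, mem_univ, iff_true, div_le_iff_of_neg hγ]
  have := Real.exp_pos (γ * y)
  linarith

/-- **`(gevMeasure γ)(−∞, x] = G_γ(x)` for all `γ` and `x`** — the measure has the printed distribution
function (1.1.9) with its endpoint conventions. [cite: deHaanFerreira2006, Theorem 1.1.3 (1.1.9), §1.1.3 (a)–(c)] -/
theorem gevMeasure_real_Iic (γ x : ℝ) : (gevMeasure γ).real (Iic x) = gevCDF γ x := by
  by_cases hγ : γ = 0
  · rw [hγ, gevMeasure_zero, gevCDF_zero, gumbelMeasure_real_Iic]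
  rw [gevMeasure_of_ne_zero hγ, map_measureReal_apply (measurable_expTransform γ) measurableSet_Iic]
  by_cases h : 0 < 1 + γ * x
  · rw [preimage_expTransform_Iic_of_pos hγ h, gumbelMeasure_real_Iic, gevCDF_eq_gumbelCDF_log_div hγ h]
  · rw [not_lt] at h
    rcases lt_or_gt_of_ne hγ with hneg | hpos
    · rw [preimage_expTransform_Iic_of_nonpos_of_neg hneg h, gevCDF_of_nonpos_of_neg hneg h,
        probReal_univ]
    · rw [preimage_expTransform_Iic_of_nonpos_of_pos hpos h, gevCDF_of_nonpos_of_pos hpos h,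
        measureReal_empty]

/-- **The distribution function of `gevMeasure γ` is `G_γ`.** [cite: deHaanFerreira2006, Theorem 1.1.3 (1.1.9)] -/
theorem cdf_gevMeasure (γ x : ℝ) : cdf (gevMeasure γ) x = gevCDF γ x := by
  rw [cdf_eq_real, gevMeasure_real_Iic]

/-- **Characterisation**: a probability measure on `ℝ` whose distribution function is `G_γ` IS
`gevMeasure γ` (distribution functions determine laws). [cite: deHaanFerreira2006, Theorem 1.1.3 (the class of extreme value distributions is G_γ)] -/
theorem gevMeasure_eq_of_cdf_eq {μ : Measure ℝ} [IsProbabilityMeasure μ]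
    (h : ∀ x, cdf μ x = gevCDF γ x) : μ = gevMeasure γ :=
  Measure.eq_of_cdf μ (gevMeasure γ) (StieltjesFunction.ext fun x => by rw [h x, cdf_gevMeasure])

/-- `P(X > x) = 1 − G_γ(x)` under `gevMeasure γ`. [cite: deHaanFerreira2006, Theorem 1.1.3 (1.1.9)] -/
theorem gevMeasure_real_Ioi (γ x : ℝ) : (gevMeasure γ).real (Ioi x) = 1 - gevCDF γ x := by
  rw [← gevMeasure_real_Iic, ← compl_Iic, measureReal_compl measurableSet_Iic, probReal_univ]

end GEVMeasure

/-! ### v2 — the support endpoints, and the Fréchet class (a) at the level of measures -/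

section GEVSupport

variable {γ : ℝ}

/-- **(a) `γ > 0`: no mass at or below the left endpoint `−1/γ`.** [cite: deHaanFerreira2006, §1.1.3 (a)] -/
theorem gevMeasure_real_Iic_eq_zero_of_pos (hγ : 0 < γ) {x : ℝ} (h : 1 + γ * x ≤ 0) :
    (gevMeasure γ).real (Iic x) = 0 := by
  rw [gevMeasure_real_Iic, gevCDF_of_nonpos_of_pos hγ h]

/-- **(c) `γ < 0`: no mass beyond the right endpoint `−1/γ`** ("For `γ < 0` the right endpoint of
the distribution is `−1/γ`"). [cite: deHaanFerreira2006, §1.1.3 (c)] -/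
theorem gevMeasure_real_Ioi_eq_zero_of_neg (hγ : γ < 0) {x : ℝ} (h : 1 + γ * x ≤ 0) :
    (gevMeasure γ).real (Ioi x) = 0 := by
  rw [gevMeasure_real_Ioi, gevCDF_of_nonpos_of_neg hγ h, sub_self]

/-- In particular (`γ < 0`) the right endpoint itself carries the full mass below it:
`(gevMeasure γ)(−∞, −1/γ] = 1`. [cite: deHaanFerreira2006, §1.1.3 (c)] -/
theorem gevMeasure_real_Iic_rightEndpoint (hγ : γ < 0) :
    (gevMeasure γ).real (Iic (-1 / γ)) = 1 := by
  rw [gevMeasure_real_Iic, gevCDF_of_nonpos_of_neg hγ (by rw [mul_div_cancel₀ _ hγ.ne]; norm_num)]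

/-- And (`γ > 0`) the left endpoint carries no mass: `(gevMeasure γ)(−∞, −1/γ] = 0`.
[cite: deHaanFerreira2006, §1.1.3 (a)] -/
theorem gevMeasure_real_Iic_leftEndpoint (hγ : 0 < γ) :
    (gevMeasure γ).real (Iic (-1 / γ)) = 0 :=
  gevMeasure_real_Iic_eq_zero_of_pos hγ (by rw [mul_div_cancel₀ _ hγ.ne']; norm_num)

end GEVSupport

section FrechetClass

variable {γ : ℝ}

/-- **(a) The Fréchet class at the level of measures**: for `γ > 0`, `G_γ` is the law of `(X − 1)/γ` for
`X ∼ Φ_{1/γ}` (Fréchet), i.e. `gevMeasure γ = (frechetMeasure (1/γ)).map (x ↦ (x − 1)/γ)` ("For `γ > 0`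
use `G_γ((x − 1)/γ)` and get with `α = 1/γ > 0`, `Φ_α(x)`"; distribution functions agree by
`FrechetLaw.gevCDF_sub_one_div`, and distribution functions determine laws). [cite: deHaanFerreira2006, §1.1.3 (a)] -/
theorem gevMeasure_eq_map_frechetMeasure (hγ : 0 < γ) :
    gevMeasure γ = (frechetMeasure (1 / γ)).map fun x => (x - 1) / γ := by
  have hα : 0 < 1 / γ := one_div_pos.2 hγ
  haveI := isProbabilityMeasure_frechetMeasure hα
  have hmeas : Measurable fun x : ℝ => (x - 1) / γ := (measurable_id.sub measurable_const).div_const γ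
  haveI : IsProbabilityMeasure ((frechetMeasure (1 / γ)).map fun x => (x - 1) / γ) :=
    Measure.isProbabilityMeasure_map hmeas.aemeasurable
  symm
  refine gevMeasure_eq_of_cdf_eq fun x => ?_
  have hpre : (fun y : ℝ => (y - 1) / γ) ⁻¹' Iic x = Iic (1 + γ * x) := by
    ext y
    simp only [mem_preimage, mem_Iic, div_le_iff₀ hγ]
    constructor <;> intro h <;> linarith
  rw [cdf_eq_real, map_measureReal_apply hmeas measurableSet_Iic, hpre, frechetMeasure_real_Iic hα,
    ← gevCDF_sub_one_div hγ]
  congr 1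
  field_simp
  ring

end FrechetClass

/-! ### v3 — the reverse-Weibull law `Ψ_α` as a measure, and class (c) at the level of measures -/

section ReverseWeibull

variable {α γ : ℝ}

/-- **The reverse-Weibull law `Ψ_α` as a measure** (`α > 0` intended): the law of `−e^{−Y/α}` for
`Y ∼ G_0`, whose distribution function is `Ψ_α(x) = exp(−(−x)^α)` (`x < 0`), `1` (`x ≥ 0`) —
`FrechetLaw.reverseWeibullCDF`. [cite: deHaanFerreira2006, §1.1.3 (c) (Ψ_α, "reverse-Weibull class")] -/
def reverseWeibullMeasure (α : ℝ) : Measure ℝ := gumbelMeasure.map fun y => -Real.exp (-y / α)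

/-- The coordinate change `y ↦ −e^{−y/α}` is measurable. [folklore] -/
private theorem measurable_negExpTransform (α : ℝ) : Measurable fun y : ℝ => -Real.exp (-y / α) :=
  (Real.measurable_exp.comp (measurable_neg.div_const α)).neg

/-- `Ψ_α` is a probability measure. [cite: deHaanFerreira2006, §1.1.3 (c)] -/
instance isProbabilityMeasure_reverseWeibullMeasure (α : ℝ) :
    IsProbabilityMeasure (reverseWeibullMeasure α) :=
  Measure.isProbabilityMeasure_map (measurable_negExpTransform α).aemeasurable

/-- **The distribution function of `reverseWeibullMeasure α` is `Ψ_α`** (`α > 0`): for `x < 0`,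
`P(−e^{−Y/α} ≤ x) = P(Y ≤ −α log(−x)) = G_0(−α log(−x)) = exp(−(−x)^α)`; for `x ≥ 0` the event is sure.
[cite: deHaanFerreira2006, §1.1.3 (c) (Ψ_α)] -/
theorem reverseWeibullMeasure_real_Iic (hα : 0 < α) (x : ℝ) :
    (reverseWeibullMeasure α).real (Iic x) = reverseWeibullCDF α x := by
  rw [reverseWeibullMeasure, map_measureReal_apply (measurable_negExpTransform α) measurableSet_Iic]
  rcases lt_or_ge x 0 with hx | hx
  · have hpre : (fun y : ℝ => -Real.exp (-y / α)) ⁻¹' Iic x = Iic (-α * Real.log (-x)) := by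
      ext y
      simp only [mem_preimage, mem_Iic, neg_le]
      rw [← Real.exp_log (neg_pos.2 hx), Real.exp_le_exp, Real.exp_log (neg_pos.2 hx)]
      constructor
      · intro h
        have := mul_le_mul_of_nonneg_left h hα.le
        rw [mul_div_cancel₀ _ hα.ne'] at this
        linarith
      · intro h
        rw [le_div_iff₀ hα]
        linarith
    rw [hpre, gumbelMeasure_real_Iic, reverseWeibullCDF_of_neg hx, gumbelCDF,
      Real.rpow_def_of_pos (neg_pos.2 hx), neg_mul, neg_neg, mul_comm]
  · have hpre : (fun y : ℝ => -Real.exp (-y / α)) ⁻¹' Iic x = univ := by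
      ext y
      simp only [mem_preimage, mem_Iic, mem_univ, iff_true]
      have := Real.exp_pos (-y / α)
      linarith
    rw [hpre, probReal_univ, reverseWeibullCDF_of_nonneg hx]

/-- The distribution function, `cdf` form. [cite: deHaanFerreira2006, §1.1.3 (c)] -/
theorem cdf_reverseWeibullMeasure (hα : 0 < α) (x : ℝ) :
    cdf (reverseWeibullMeasure α) x = reverseWeibullCDF α x := by
  rw [cdf_eq_real, reverseWeibullMeasure_real_Iic hα]

/-- `Ψ_α` has right endpoint `0`: no mass on `(0, ∞)`. [cite: deHaanFerreira2006, §1.1.3 (c)] -/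
theorem reverseWeibullMeasure_real_Ioi_zero (hα : 0 < α) : (reverseWeibullMeasure α).real (Ioi 0) = 0 := by
  rw [← compl_Iic, measureReal_compl measurableSet_Iic, probReal_univ, reverseWeibullMeasure_real_Iic hα,
    reverseWeibullCDF_of_nonneg le_rfl, sub_self]

/-- **(c) The reverse-Weibull class at the level of measures**: for `γ < 0`, `G_γ` is the law of
`−(1 + X)/γ` for `X ∼ Ψ_{−1/γ}`, i.e. `gevMeasure γ = (reverseWeibullMeasure (−1/γ)).map (x ↦ −(1 + x)/γ)`
("For `γ < 0` use `G_γ(−(1 + x)/γ)` and get with `α = −1/γ > 0`, `Ψ_α(x)`"; distribution functions agree by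
`FrechetLaw.gevCDF_neg_one_add_div`). [cite: deHaanFerreira2006, §1.1.3 (c)] -/
theorem gevMeasure_eq_map_reverseWeibullMeasure (hγ : γ < 0) :
    gevMeasure γ = (reverseWeibullMeasure (-1 / γ)).map fun x => -(1 + x) / γ := by
  have hα : 0 < -1 / γ := div_pos_of_neg_of_neg (by norm_num) hγ
  have hmeas : Measurable fun x : ℝ => -(1 + x) / γ := (measurable_const.add measurable_id).neg.div_const γ
  haveI : IsProbabilityMeasure ((reverseWeibullMeasure (-1 / γ)).map fun x => -(1 + x) / γ) :=
    Measure.isProbabilityMeasure_map hmeas.aemeasurable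
  symm
  refine gevMeasure_eq_of_cdf_eq fun x => ?_
  -- `−(1 + y)/γ ≤ x ↔ y ≤ −(1 + γx)` (divide by the negative `γ`)
  have hpre : (fun y : ℝ => -(1 + y) / γ) ⁻¹' Iic x = Iic (-(1 + γ * x)) := by
    ext y
    simp only [mem_preimage, mem_Iic, div_le_iff_of_neg hγ]
    constructor <;> intro h <;> nlinarith
  have hγ0 : γ ≠ 0 := hγ.ne
  rw [cdf_eq_real, map_measureReal_apply hmeas measurableSet_Iic, hpre, reverseWeibullMeasure_real_Iic hα,
    ← gevCDF_neg_one_add_div hγ]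
  congr 1
  field_simp
  ring

end ReverseWeibull

end Literature.Probability.HeavyTails
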